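import Literature.AlgebraicGeometry.Frobenioids.BiratGerms
import Literature.AlgebraicGeometry.Frobenioids.PrimaryStepsComplete
import Mathlib.CategoryTheory.Functor.ReflectsIso.Basic
import HarnessLib

/-!
# [FrdI] Theorem 4.9, proof p. 90 ll. 28–45: twin-primary steps from a pair of Proposition 4.1 (iii) squares

Mochizuki, *The geometry of Frobenioids I: the general theory*, Kyushu J. Math. **62** (2008)
293–400, §4, proof of Theorem 4.9, kurims text p. 90 ll. 28–45 [cite: MochizukiFrdI2008, Thm. 4.9 p.90]:

> "Conversely, given any pair of cartesian diagrams of pre-steps as in Proposition 4.1, (iii),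
> [`C →γ' D`, `γ : C → B`, `δ : D → A`, `β : B → A`] and [`C →γ' D`, `γ'' : C → A`, `δ' : D → F`,
> `α : A → F`] in which `α`, `β` are primary with zero divisor in `𝔭`; the pre-steps `ζ := β ∘ γ : C → A`,
> `γ'' : C → A` are Div-equivalent [e.g., base-equivalent], it follows immediately that `α`, `β` are
> twin-primary" [i.e. `Div(α) = (Φ(β))⁻¹(Div(β))`, p. 89 l. 47 – p. 90 l. 1].

PROOF-ONLY file (seat abc-iut-w4-d105, D-0068 sub-DAG S5 row `FrdI:Thm4.9/T49-L08`, piece): the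
DIVISOR COMPUTATION underlying this sentence, over an arbitrary pre-Frobenioid structure
`F : C → F_Φ` and the tree's Def. 1.2/1.3 API (`Base`, `Div`, `pull`, `invDiv`, `DivEquivalent`). The two
squares enter only through (a) their commutativity and (b) the two divisor identities that Proposition
4.1 (iii) attaches to its cartesian squares, "`ε_*(ε'_*(Div ε')) = ι_*(Div ι)`" (p. 75), here
`δ_*(γ'_*Div γ') = β_*Div β` (first square) and `δ'_*(γ'_*Div γ') = α_*Div α` (second square); no
Frobenioid axiom is used. Nothing of [FrdI] is restated; typed ≠ proved for the row itself.
-/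

namespace Literature.AlgebraicGeometry.Frobenioids

open CategoryTheory Opposite

universe w v v' u u'

-- the `(F ⋙ G).obj X` / `G.obj (F.obj X)` bookkeeping of the transport lemmas (as in the tree's
-- `Equivalence*.lean` files)
set_option backward.isDefEq.respectTransparency false

namespace PreFrobenioid

variable {D : Type u} [Category.{v} D] {Φ : Dᵒᵖ ⥤ CommMonCat.{w}}
  {C : Type u'} [Category.{v'} C] (F : C ⥤ ElemFrobenioid Φ)

/-- From the two commutative squares `γ' ≫ δ = γ ≫ β`, `γ' ≫ δ' = γ'' ≫ α` with `γ'` a base-isomorphism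
and `β ∘ γ`, `γ''` Div-equivalent: `Φ(δ') = Φ(α ∘ δ)`, i.e. `(δ')^* = δ^* ∘ α^*` on `Φ(F_D)`.
[cite: MochizukiFrdI2008, Thm. 4.9 p.90] -/
theorem pull_base_eq_of_squares {A B C' D' F' : C} (α : A ⟶ F') (β : B ⟶ A) (γ : C' ⟶ B)
    (γ' : C' ⟶ D') (δ : D' ⟶ A) (γ'' : C' ⟶ A) (δ' : D' ⟶ F') (hγ' : IsBaseIso F γ')
    (sq₁ : γ' ≫ δ = γ ≫ β) (sq₂ : γ' ≫ δ' = γ'' ≫ α) (hde : DivEquivalent F (γ ≫ β) γ'')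
    (x : Φ.obj (op (baseObj F F'))) :
    pull Φ (Base F δ') x = pull Φ (Base F δ) (pull Φ (Base F α) x) := by
  haveI : IsIso (Base F γ') := hγ'
  apply pull_injective (Base F γ')
  have h1 : pull Φ (Base F γ') (pull Φ (Base F δ') x) = pull Φ (Base F γ'') (pull Φ (Base F α) x) := by
    rw [← pull_comp, ← base_comp, sq₂, base_comp, pull_comp]
  have h2 : pull Φ (Base F γ') (pull Φ (Base F δ) (pull Φ (Base F α) x)) =
      pull Φ (Base F (γ ≫ β)) (pull Φ (Base F α) x) := by
    rw [← pull_comp, ← base_comp, sq₁]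
  rw [h1, h2]
  exact (DFunLike.congr_fun hde (pull Φ (Base F α) x)).symm

/-- **Twin-primarity from a pair of Proposition 4.1 (iii) squares** ([FrdI] proof of Thm. 4.9,
p. 90 ll. 28–45, "it follows immediately that `α`, `β` are twin-primary"): given the commutative squares
`γ' ≫ δ = γ ≫ β` and `γ' ≫ δ' = γ'' ≫ α` of base-isomorphisms with `β ∘ γ`, `γ''` Div-equivalent, and
the divisor identities of Proposition 4.1 (iii) for both squares — `δ_*(γ'_*Div γ') = β_*(Div β)` and
`δ'_*(γ'_*Div γ') = α_*(Div α)` — one has `Div(α) = (Φ(β))⁻¹(Div β)`, i.e. `α`, `β` are twin-primary.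
[cite: MochizukiFrdI2008, Thm. 4.9 p.90] -/
theorem div_eq_invDiv_of_prop41iii_squares {A B C' D' F' : C} (α : A ⟶ F') (β : B ⟶ A)
    (γ : C' ⟶ B) (γ' : C' ⟶ D') (δ : D' ⟶ A) (γ'' : C' ⟶ A) (δ' : D' ⟶ F')
    (hα : IsBaseIso F α) (hβ : IsBaseIso F β) (hγ' : IsBaseIso F γ') (hδ : IsBaseIso F δ)
    (hδ' : IsBaseIso F δ')
    (sq₁ : γ' ≫ δ = γ ≫ β) (sq₂ : γ' ≫ δ' = γ'' ≫ α) (hde : DivEquivalent F (γ ≫ β) γ'')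
    (I₁ : haveI : IsIso (Base F δ) := hδ
      pull Φ (inv (Base F δ)) (invDiv F γ' hγ') = invDiv F β hβ)
    (I₂ : haveI : IsIso (Base F δ') := hδ'
      haveI : IsIso (Base F α) := hα
      pull Φ (inv (Base F δ')) (invDiv F γ' hγ') = pull Φ (inv (Base F α)) (Div F α)) :
    Div F α = invDiv F β hβ := by
  haveI : IsIso (Base F δ) := hδ
  haveI : IsIso (Base F δ') := hδ'
  haveI : IsIso (Base F α) := hα
  -- `γ'_* Div γ' = δ^*(β_* Div β)` from the first identity
  have hγ'β : invDiv F γ' hγ' = pull Φ (Base F δ) (invDiv F β hβ) := by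
    rw [← I₁, pull_pull_inv_eq]
  -- the key Φ-level relation `(δ')^* = δ^* ∘ α^*` evaluated at `α_*((Φ β)⁻¹ Div β)`
  have key : pull Φ (Base F δ') (pull Φ (inv (Base F α)) (invDiv F β hβ)) =
      pull Φ (Base F δ) (invDiv F β hβ) := by
    rw [pull_base_eq_of_squares F α β γ γ' δ γ'' δ' hγ' sq₁ sq₂ hde, pull_pull_inv_eq]
  apply pull_injective (inv (Base F α))
  rw [← I₂, hγ'β, ← key, pull_inv_pull_eq]

/-! ### The divisor identities hold for EVERY cartesian square over a co-primary pair -/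

/-- Uniqueness of cartesian squares of pre-steps: if `(U, ε', ι')` and `(U₂, ε₂, ι₂)` are both
cartesian (among pre-steps) over the same pair `ε : E → F`, `ι : I → F`, the comparison arrow
`u : U₂ → U` with `u ≫ ε' = ε₂`, `u ≫ ι' = ι₂` is an isomorphism. [folklore] -/
private theorem isIso_comparison_of_cartesian {E I F' U U₂ : C} {ε : E ⟶ F'} {ι : I ⟶ F'}
    {ε' : U ⟶ E} {ι' : U ⟶ I} {ε₂ : U₂ ⟶ E} {ι₂ : U₂ ⟶ I}
    (hε' : IsPreStep F ε') (hι' : IsPreStep F ι') (hsq : ε' ≫ ε = ι' ≫ ι)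
    (hcart : ∀ ⦃V : C⦄ (a : V ⟶ E) (b : V ⟶ I), IsPreStep F a → IsPreStep F b → a ≫ ε = b ≫ ι →
      ∃! u : V ⟶ U, u ≫ ε' = a ∧ u ≫ ι' = b)
    (hε₂ : IsPreStep F ε₂) (hι₂ : IsPreStep F ι₂) (hsq₂ : ε₂ ≫ ε = ι₂ ≫ ι)
    (hcart₂ : ∀ ⦃V : C⦄ (a : V ⟶ E) (b : V ⟶ I), IsPreStep F a → IsPreStep F b → a ≫ ε = b ≫ ι →
      ∃! u : V ⟶ U₂, u ≫ ε₂ = a ∧ u ≫ ι₂ = b)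
    {u : U₂ ⟶ U} (hu : u ≫ ε' = ε₂ ∧ u ≫ ι' = ι₂) : IsIso u := by
  obtain ⟨u', hu', -⟩ := hcart₂ ε' ι' hε' hι' hsq
  refine ⟨u', ?_, ?_⟩
  · -- `u ≫ u' = 𝟙 U₂` by uniqueness in the second square
    obtain ⟨w, -, hw⟩ := hcart₂ ε₂ ι₂ hε₂ hι₂ hsq₂
    have h1 : u ≫ u' = w := hw _ ⟨by rw [Category.assoc, hu'.1, hu.1], by rw [Category.assoc, hu'.2, hu.2]⟩
    have h2 : 𝟙 U₂ = w := hw _ ⟨by rw [Category.id_comp], by rw [Category.id_comp]⟩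
    rw [h1, ← h2]
  · -- `u' ≫ u = 𝟙 U` by uniqueness in the first square
    obtain ⟨w, -, hw⟩ := hcart ε' ι' hε' hι' hsq
    have h1 : u' ≫ u = w := hw _ ⟨by rw [Category.assoc, hu.1, hu'.1], by rw [Category.assoc, hu.2, hu'.2]⟩
    have h2 : 𝟙 U = w := hw _ ⟨by rw [Category.id_comp], by rw [Category.id_comp]⟩
    rw [h1, ← h2]

/-- **The divisor identities of Proposition 4.1 (iii) hold for ANY cartesian square of pre-steps over a
co-primary pair of pre-steps** (Frobenioid of perfect and isotropic type, `Φ` perf-factorial): the square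
of `exists_coprimary_square_of_isCoprimary` carries them (FrdI pp. 75–77), cartesian squares are unique
up to an isomorphism, and isomorphisms are isometries (`Φ` sharp). This is what "cartesian commutative
diagrams of pre-steps as in Proposition 4.1, (iii)" (proof of Thm. 4.9, p. 90) supplies.
[cite: MochizukiFrdI2008, Prop. 4.1 (iii) p.75] -/
theorem prop41iii_identities_of_cartesian (hF : IsFrobenioid F) (hperf : IsOfPerfectType F)
    (histr : IsOfIsotropicType F) (hpf : Objectwise (fun M _ => IsPerfFactorial M) Φ) {E I F' U₂ : C}
    {ε : E ⟶ F'} {ι : I ⟶ F'} (hε : IsPreStep F ε) (hι : IsPreStep F ι)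
    (hcop : ∀ ⦃Z : C⦄ (ζ : Z ⟶ F'), IsPreStep F ζ →
      (∃ (ε' : E ⟶ Z) (ι' : I ⟶ Z), IsPreStep F ε' ∧ IsPreStep F ι' ∧ ε' ≫ ζ = ε ∧ ι' ≫ ζ = ι) →
        IsIso ζ)
    {ε₂ : U₂ ⟶ E} {ι₂ : U₂ ⟶ I} (hε₂ : IsPreStep F ε₂) (hι₂ : IsPreStep F ι₂) (hsq₂ : ε₂ ≫ ε = ι₂ ≫ ι)
    (hcart₂ : ∀ ⦃V : C⦄ (a : V ⟶ E) (b : V ⟶ I), IsPreStep F a → IsPreStep F b → a ≫ ε = b ≫ ι →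
      ∃! u : V ⟶ U₂, u ≫ ε₂ = a ∧ u ≫ ι₂ = b) :
    (∀ yι : Φ.obj (op (baseObj F F')), pull Φ (Base F ι) yι = Div F ι →
        pull Φ (Base F (ε₂ ≫ ε)) yι = Div F ε₂) ∧
      (∀ yε : Φ.obj (op (baseObj F F')), pull Φ (Base F ε) yε = Div F ε →
        pull Φ (Base F (ι₂ ≫ ι)) yε = Div F ι₂) := by
  obtain ⟨U, ε', ι', hε', hι', hsq, hcart, hidε, hidι, -⟩ :=
    exists_coprimary_square hF histr hε hι fun _ hdε hdι =>
      (hpf (baseObj F F')).mul_dvd_of_forall_common_dvd_eq_one (isPerfect_divisorMonoid hF hperf F')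
        ((isCoprimary_iff_forall_dvd hF histr hε hι).mp hcop) hdε hdι
  obtain ⟨u, hu, -⟩ := hcart ε₂ ι₂ hε₂ hι₂ hsq₂
  haveI : IsIso u := isIso_comparison_of_cartesian F hε' hι' hsq hcart hε₂ hι₂ hsq₂ hcart₂ hu
  have hDu : Div F u = 1 := isIsometry_of_isIso F hF.isPreFrobenioid u
  refine ⟨fun yι hyι => ?_, fun yε hyε => ?_⟩
  · rw [← hu.1, Category.assoc, base_comp, pull_comp, hidε yι hyι, div_comp_of_isLinear u hε'.1, hDu,
      mul_one]
  · rw [← hu.2, Category.assoc, base_comp, pull_comp, hidι yε hyε, div_comp_of_isLinear u hι'.1, hDu,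
      mul_one]

/-! ### Transport of co-primarity and of cartesian squares of pre-steps along an equivalence -/

section Transport

variable {F}
variable {D₂ : Type u} [Category.{v} D₂] {Φ₂ : D₂ᵒᵖ ⥤ CommMonCat.{w}} {C₂ : Type u'} [Category.{v'} C₂]
  {F₂ : C₂ ⥤ ElemFrobenioid Φ₂} (Ψ : C ≌ C₂)

/-- A pre-step followed by an isomorphism is a pre-step. [cite: MochizukiFrdI2008, Def. 1.2(iii)] -/
theorem IsPreStep.comp_iso {X Y Z : C} {f : X ⟶ Y} (hf : IsPreStep F f) (g : Y ⟶ Z) [IsIso g] :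
    IsPreStep F (f ≫ g) :=
  IsPreStep.comp F hf (isPreStep_of_isIso F g)

/-- An isomorphism followed by a pre-step is a pre-step. [cite: MochizukiFrdI2008, Def. 1.2(iii)] -/
theorem IsPreStep.iso_comp {X Y Z : C} (g : X ⟶ Y) [IsIso g] {f : Y ⟶ Z} (hf : IsPreStep F f) :
    IsPreStep F (g ≫ f) :=
  IsPreStep.comp F (isPreStep_of_isIso F g) hf

/-- The components of `η⁻¹` are isomorphisms (restated with the objects in the form `Ψ⁻¹ (Ψ X) ⟶ X`
in which they occur below). [folklore] -/
private theorem isIso_unitInv_app' (X : C) :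
    IsIso (Ψ.unitInv.app X : Ψ.inverse.obj (Ψ.functor.obj X) ⟶ X) :=
  inferInstanceAs (IsIso (Ψ.unitInv.app X))

/-- The components of `η` are isomorphisms. [folklore] -/
private theorem isIso_unit_app' (X : C) : IsIso (Ψ.unit.app X : X ⟶ Ψ.inverse.obj (Ψ.functor.obj X)) :=
  inferInstanceAs (IsIso (Ψ.unit.app X))

/-- The components of `ε⁻¹` are isomorphisms. [folklore] -/
private theorem isIso_counitInv_app' (V : C₂) :
    IsIso (Ψ.counitInv.app V : V ⟶ Ψ.functor.obj (Ψ.inverse.obj V)) :=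
  inferInstanceAs (IsIso (Ψ.counitInv.app V))

/-- Pulling a factorisation `χ' ≫ ζ = Ψ χ` back to `C`: `(η_X ≫ Ψ⁻¹ χ') ≫ (Ψ⁻¹ ζ ≫ η⁻¹_{F'}) = χ`.
[folklore] -/
private theorem unit_inverse_map_comp_eq {X F' : C} {Z : C₂} (χ' : Ψ.functor.obj X ⟶ Z)
    (ζ : Z ⟶ Ψ.functor.obj F') (χ : X ⟶ F') (h : χ' ≫ ζ = Ψ.functor.map χ) :
    (Ψ.unit.app X ≫ Ψ.inverse.map χ') ≫ (Ψ.inverse.map ζ ≫ Ψ.unitInv.app F') = χ := by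
  have h' := congrArg Ψ.inverse.map h
  simp only [Functor.map_comp, Equivalence.inv_fun_map] at h'
  simp only [Category.assoc]
  rw [reassoc_of% h']
  simp

/-- If `w₁ ≫ χ = Ψ⁻¹ c ≫ η⁻¹_X` then `(ε⁻¹_V ≫ Ψ w₁) ≫ Ψ χ = c`. [folklore] -/
private theorem counitInv_functor_map_comp_eq {V : C₂} {X U₂ : C} (w₁ : Ψ.inverse.obj V ⟶ U₂) (χ : U₂ ⟶ X)
    (c : V ⟶ Ψ.functor.obj X) (hw : w₁ ≫ χ = Ψ.inverse.map c ≫ Ψ.unitInv.app X) :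
    (Ψ.counitInv.app V ≫ Ψ.functor.map w₁) ≫ Ψ.functor.map χ = c := by
  rw [Category.assoc, ← Ψ.functor.map_comp, hw, Ψ.functor.map_comp, Equivalence.fun_inv_map]
  simp [← Equivalence.counit_app_functor]

/-- If `u' ≫ Ψ χ = c` then `(Ψ⁻¹ u' ≫ η⁻¹) ≫ χ = Ψ⁻¹ c ≫ η⁻¹_X`. [folklore] -/
private theorem inverse_map_comp_unitInv_comp_eq {V : C₂} {X U₂ : C} (u' : V ⟶ Ψ.functor.obj U₂)
    (χ : U₂ ⟶ X) (c : V ⟶ Ψ.functor.obj X) (hc : u' ≫ Ψ.functor.map χ = c) :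
    (Ψ.inverse.map u' ≫ Ψ.unitInv.app U₂) ≫ χ = Ψ.inverse.map c ≫ Ψ.unitInv.app X := by
  subst hc
  simp [Equivalence.inv_fun_map]

/-- `ε⁻¹_V ≫ Ψ (Ψ⁻¹ u' ≫ η⁻¹) = u'`. [folklore] -/
private theorem counitInv_functor_map_inverse_map {V : C₂} {U₂ : C} (u' : V ⟶ Ψ.functor.obj U₂) :
    Ψ.counitInv.app V ≫ Ψ.functor.map (Ψ.inverse.map u' ≫ Ψ.unitInv.app U₂) = u' := by
  simp [Equivalence.fun_inv_map, ← Equivalence.counit_app_functor]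

/-- **Co-primarity is categorical, hence transported by an equivalence** whose quasi-inverse carries
pre-steps to pre-steps ([FrdI] Thm. 3.4 (ii)): if every pre-step `ζ : Z → F'` through which `ε`, `ι`
both factor by pre-steps is an isomorphism, the same holds for `Ψ ε`, `Ψ ι`.
[cite: MochizukiFrdI2008, Thm. 4.9 p.90] -/
theorem coprimary_map
    (hinv : ∀ ⦃X Y : C₂⦄ (φ : X ⟶ Y), IsPreStep F₂ φ → IsPreStep F (Ψ.inverse.map φ))
    {E I F' : C} {ε : E ⟶ F'} {ι : I ⟶ F'}
    (hcop : ∀ ⦃Z : C⦄ (ζ : Z ⟶ F'), IsPreStep F ζ →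
      (∃ (ε' : E ⟶ Z) (ι' : I ⟶ Z), IsPreStep F ε' ∧ IsPreStep F ι' ∧ ε' ≫ ζ = ε ∧ ι' ≫ ζ = ι) →
        IsIso ζ) :
    ∀ ⦃Z : C₂⦄ (ζ : Z ⟶ Ψ.functor.obj F'), IsPreStep F₂ ζ →
      (∃ (ε' : Ψ.functor.obj E ⟶ Z) (ι' : Ψ.functor.obj I ⟶ Z), IsPreStep F₂ ε' ∧ IsPreStep F₂ ι' ∧
          ε' ≫ ζ = Ψ.functor.map ε ∧ ι' ≫ ζ = Ψ.functor.map ι) →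
        IsIso ζ := by
  rintro Z ζ hζ ⟨ε', ι', hε', hι', hεζ, hιζ⟩
  haveI := isIso_unitInv_app' Ψ F'
  haveI := isIso_unit_app' Ψ E
  haveI := isIso_unit_app' Ψ I
  -- pull the factorisation back to `C` along `Ψ.inverse` and the unit isomorphism
  have hζ₁p : IsPreStep F (Ψ.inverse.map ζ ≫ Ψ.unitInv.app F') := IsPreStep.comp_iso (hinv ζ hζ) _
  haveI : IsIso (Ψ.inverse.map ζ ≫ Ψ.unitInv.app F') :=
    hcop _ hζ₁p ⟨Ψ.unit.app E ≫ Ψ.inverse.map ε', Ψ.unit.app I ≫ Ψ.inverse.map ι',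
      IsPreStep.iso_comp _ (hinv ε' hε'), IsPreStep.iso_comp _ (hinv ι' hι'),
      unit_inverse_map_comp_eq Ψ ε' ζ ε hεζ, unit_inverse_map_comp_eq Ψ ι' ζ ι hιζ⟩
  haveI : IsIso (Ψ.inverse.map ζ) := IsIso.of_isIso_comp_right (Ψ.inverse.map ζ) (Ψ.unitInv.app F')
  exact isIso_of_reflects_iso ζ Ψ.inverse

/-- **Cartesian squares of pre-steps are transported by an equivalence** whose quasi-inverse carries
pre-steps to pre-steps: if `ε₂ ≫ ε = ι₂ ≫ ι` is cartesian among pre-steps in `C`, so is its image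
under `Ψ.functor`. [cite: MochizukiFrdI2008, Thm. 4.9 p.90] -/
theorem cartesian_map
    (hinv : ∀ ⦃X Y : C₂⦄ (φ : X ⟶ Y), IsPreStep F₂ φ → IsPreStep F (Ψ.inverse.map φ))
    {E I F' U₂ : C} {ε : E ⟶ F'} {ι : I ⟶ F'} {ε₂ : U₂ ⟶ E} {ι₂ : U₂ ⟶ I}
    (hcart : ∀ ⦃V : C⦄ (a : V ⟶ E) (b : V ⟶ I), IsPreStep F a → IsPreStep F b → a ≫ ε = b ≫ ι →
      ∃! u : V ⟶ U₂, u ≫ ε₂ = a ∧ u ≫ ι₂ = b) :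
    ∀ ⦃V : C₂⦄ (a : V ⟶ Ψ.functor.obj E) (b : V ⟶ Ψ.functor.obj I), IsPreStep F₂ a →
      IsPreStep F₂ b → a ≫ Ψ.functor.map ε = b ≫ Ψ.functor.map ι →
        ∃! u : V ⟶ Ψ.functor.obj U₂, u ≫ Ψ.functor.map ε₂ = a ∧ u ≫ Ψ.functor.map ι₂ = b := by
  intro V a b ha hb hab
  haveI := isIso_unitInv_app' Ψ E
  haveI := isIso_unitInv_app' Ψ I
  -- transport `(a, b)` to a pair of pre-steps out of `Ψ⁻¹ V`
  have ha₁p : IsPreStep F (Ψ.inverse.map a ≫ Ψ.unitInv.app E) := IsPreStep.comp_iso (hinv a ha) _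
  have hb₁p : IsPreStep F (Ψ.inverse.map b ≫ Ψ.unitInv.app I) := IsPreStep.comp_iso (hinv b hb) _
  have hab₁ : (Ψ.inverse.map a ≫ Ψ.unitInv.app E) ≫ ε = (Ψ.inverse.map b ≫ Ψ.unitInv.app I) ≫ ι := by
    rw [inverse_map_comp_unitInv_comp_eq Ψ a ε (a ≫ Ψ.functor.map ε) rfl,
      inverse_map_comp_unitInv_comp_eq Ψ b ι (b ≫ Ψ.functor.map ι) rfl, hab]
  obtain ⟨u₁, ⟨hu₁a, hu₁b⟩, hu₁uniq⟩ := hcart _ _ ha₁p hb₁p hab₁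
  refine ⟨Ψ.counitInv.app V ≫ Ψ.functor.map u₁,
    ⟨counitInv_functor_map_comp_eq Ψ u₁ ε₂ a hu₁a, counitInv_functor_map_comp_eq Ψ u₁ ι₂ b hu₁b⟩, ?_⟩
  -- uniqueness: transport a competitor back to `C`
  rintro u' ⟨hu'a, hu'b⟩
  have h1 : Ψ.inverse.map u' ≫ Ψ.unitInv.app U₂ = u₁ :=
    hu₁uniq _ ⟨inverse_map_comp_unitInv_comp_eq Ψ u' ε₂ a hu'a,
      inverse_map_comp_unitInv_comp_eq Ψ u' ι₂ b hu'b⟩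
  rw [← h1, counitInv_functor_map_inverse_map]

end Transport

/-! ### Assembly: twin-primary steps from a pair of co-primary cartesian squares, on both sides of `Ψ` -/

/-- **[FrdI] proof of Thm. 4.9, p. 90 ll. 28–45, one Frobenioid**: in a Frobenioid of perfect and
isotropic type with `Φ` perf-factorial, given commutative squares of pre-steps `γ' ≫ δ = γ ≫ β` (over
`A`) and `γ' ≫ δ' = γ'' ≫ α` (over `F`), both cartesian among pre-steps, with `(δ, β)` and `(δ', α)`
CO-PRIMARY ("cartesian commutative diagrams of pre-steps as in Proposition 4.1, (iii)") and
`β ∘ γ`, `γ''` Div-equivalent, one has `Div(α) = (Φ(β))⁻¹(Div β)`: "it follows immediately that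
`α`, `β` are twin-primary". [cite: MochizukiFrdI2008, Thm. 4.9 p.90] -/
theorem div_eq_invDiv_of_coprimary_squares (hF : IsFrobenioid F) (hperf : IsOfPerfectType F)
    (histr : IsOfIsotropicType F) (hpf : Objectwise (fun M _ => IsPerfFactorial M) Φ)
    {A B C' D' F' : C} (α : A ⟶ F') (β : B ⟶ A) (γ : C' ⟶ B) (γ' : C' ⟶ D') (δ : D' ⟶ A)
    (γ'' : C' ⟶ A) (δ' : D' ⟶ F')
    (hα : IsPreStep F α) (hβ : IsPreStep F β) (hγ : IsPreStep F γ) (hγ' : IsPreStep F γ')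
    (hδ : IsPreStep F δ) (hγ'' : IsPreStep F γ'') (hδ' : IsPreStep F δ')
    (sq₁ : γ' ≫ δ = γ ≫ β) (sq₂ : γ' ≫ δ' = γ'' ≫ α)
    (cart₁ : ∀ ⦃V : C⦄ (a : V ⟶ D') (b : V ⟶ B), IsPreStep F a → IsPreStep F b → a ≫ δ = b ≫ β →
      ∃! u : V ⟶ C', u ≫ γ' = a ∧ u ≫ γ = b)
    (cart₂ : ∀ ⦃V : C⦄ (a : V ⟶ D') (b : V ⟶ A), IsPreStep F a → IsPreStep F b → a ≫ δ' = b ≫ α →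
      ∃! u : V ⟶ C', u ≫ γ' = a ∧ u ≫ γ'' = b)
    (cop₁ : ∀ ⦃Z : C⦄ (ζ : Z ⟶ A), IsPreStep F ζ →
      (∃ (ε' : D' ⟶ Z) (ι' : B ⟶ Z), IsPreStep F ε' ∧ IsPreStep F ι' ∧ ε' ≫ ζ = δ ∧ ι' ≫ ζ = β) →
        IsIso ζ)
    (cop₂ : ∀ ⦃Z : C⦄ (ζ : Z ⟶ F'), IsPreStep F ζ →
      (∃ (ε' : D' ⟶ Z) (ι' : A ⟶ Z), IsPreStep F ε' ∧ IsPreStep F ι' ∧ ε' ≫ ζ = δ' ∧ ι' ≫ ζ = α) →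
        IsIso ζ)
    (hde : DivEquivalent F (γ ≫ β) γ'') :
    Div F α = invDiv F β hβ.2 := by
  haveI : IsIso (Base F α) := hα.2
  haveI : IsIso (Base F β) := hβ.2
  haveI : IsIso (Base F γ') := hγ'.2
  haveI : IsIso (Base F δ) := hδ.2
  haveI : IsIso (Base F δ') := hδ'.2
  -- the Prop. 4.1 (iii) identities for the two given squares
  obtain ⟨J₁, -⟩ := prop41iii_identities_of_cartesian F hF hperf histr hpf hδ hβ cop₁ hγ' hγ sq₁ cart₁
  obtain ⟨J₂, -⟩ := prop41iii_identities_of_cartesian F hF hperf histr hpf hδ' hα cop₂ hγ' hγ'' sq₂ cart₂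
  have J₁' : pull Φ (Base F (γ' ≫ δ)) (invDiv F β hβ.2) = Div F γ' := J₁ _ (pull_invDiv β hβ.2)
  have J₂' : pull Φ (Base F (γ' ≫ δ')) (pull Φ (inv (Base F α)) (Div F α)) = Div F γ' :=
    J₂ _ (pull_pull_inv_eq (Base F α) (Div F α))
  refine div_eq_invDiv_of_prop41iii_squares F α β γ γ' δ γ'' δ' hα.2 hβ.2 hγ'.2 hδ.2 hδ'.2 sq₁ sq₂ hde
    ?_ ?_
  · -- `I₁`: `δ_*(γ'_* Div γ') = β_* Div β`
    show pull Φ (inv (Base F δ)) (invDiv F γ' hγ'.2) = invDiv F β hβ.2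
    conv_lhs => rw [invDiv, ← J₁', base_comp, pull_comp, pull_inv_pull_eq, pull_inv_pull_eq]
  · -- `I₂`: `δ'_*(γ'_* Div γ') = α_* Div α`
    show pull Φ (inv (Base F δ')) (invDiv F γ' hγ'.2) = pull Φ (inv (Base F α)) (Div F α)
    conv_lhs => rw [invDiv, ← J₂', base_comp, pull_comp, pull_inv_pull_eq, pull_inv_pull_eq]

end PreFrobenioid

end Literature.AlgebraicGeometry.Frobenioids
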